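import Summits.CriticalPhenomena.SAWScalingLimit.Theorems.SAWDefectDecoherenceBoundaryClosureRBoundaryBookkeepingContour
import Summits.CriticalPhenomena.SAWScalingLimit.Theorems.SAWDefectDecoherencePickHalfPlaneDefs
import HarnessLib

/-!
# Boundary bookkeeping, VI: the root edge is no bridge of the boundary-site graph

Route `SAWDefectDecoherence`, crux `BoundaryClosureR` (stmt-CriticalPhenomena-14004), line
`pick-half-plane`, wave 5, serving `stub_halfPlaneInputs`: the registered sub-goal
`stub_halfPlaneInputs_boundaryReachOfConnected` reduces the conjunct `BoundaryReach` of the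
skeleton (reachability of every boundary site from the normaliser's site in the boundary-site graph
WITHOUT the root edge) to `BoundarySiteGraphConnected` (all non-interior lattice sites of a simply
connected, connected `Λ` lie in ONE component of the boundary-site graph, root edge allowed) by the
parity argument:

* `even_card_dartsAt` (LOCAL): every lattice site carries an EVEN number of boundary darts
  `(v ∈ Λ, t ∉ Λ)` — around the hexagon of a site the faces change between `Λ` and its complement an
  even number of times (a finite check over the `2⁶` patterns);
* `rootSites_joined` (the BRIDGE LEMMA): the two sites of the root's dual edge are joined in the
  boundary-site graph without the root — otherwise the component `C` of one of them would carry an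
  odd total degree (all sites even, minus the one root incidence inside `C`), while double counting
  the incidences (site, dart) over `C` gives an even number (each dart meeting `C` has both its
  sites in `C`);
* `reach_without_root`: hence reachability with the root edge allowed implies reachability without.
-/

noncomputable section

open Literature.Probability.LatticeModels Literature.Probability.RandomPlanarGeometry.SAW
open Literature.Barriers.CriticalPhenomena.HexGreen (nbrs mem_nbrs_iff)
open Literature.Barriers.CriticalPhenomena (HexKernel.face HexKernel.outFace HexKernel.face_inj
  HexKernel.outFace_ne_face HexKernel.adj_face_iff HexKernel.hexagonFaces
  HexKernel.mem_hexagonFaces_of_mem_hexFaceVertices HexKernel.hexGraph_adj_iff_of_snd_eq_zero_holds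
  HexKernel.not_hexGraph_adj_of_snd_eq_holds)

namespace Summit.CriticalPhenomena.SAWScalingLimit.Theorems.PickHalfPlane.BoundaryExactness

variable {Λ : Finset HexVertex}

/-! ### Local parity: an even number of boundary darts at every site -/

/-- **A dual edge at a site is a spoke of its hexagon**: if the adjacent faces `v ∼ t` both contain
the site `x`, they are two consecutive faces of the hexagon around `x`. [folklore] -/
theorem exists_face_eq_of_adj (x : Site 2) {v t : HexVertex} (hvt : hexGraph.Adj v t)
    (hxv : x ∈ hexFaceVertices v) (hxt : x ∈ hexFaceVertices t) :
    ∃ k : Fin 6, (v = HexKernel.face x k ∧ t = HexKernel.face x (k + 1)) ∨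
      (v = HexKernel.face x (k + 1) ∧ t = HexKernel.face x k) := by
  obtain ⟨a, -, rfl⟩ := Finset.mem_image.1 (HexKernel.mem_hexagonFaces_of_mem_hexFaceVertices hxv)
  obtain ⟨b, -, rfl⟩ := Finset.mem_image.1 (HexKernel.mem_hexagonFaces_of_mem_hexFaceVertices hxt)
  obtain ⟨j, rfl⟩ : ∃ j, a = j + 1 := ⟨a - 1, (sub_add_cancel a 1).symm⟩
  rcases (HexKernel.adj_face_iff HexKernel.hexGraph_adj_iff_of_snd_eq_zero_holds
      HexKernel.not_hexGraph_adj_of_snd_eq_holds x j _).1 hvt with h | h | h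
  · exact ⟨j, Or.inr ⟨rfl, h⟩⟩
  · exact ⟨j + 1, Or.inl ⟨rfl, h⟩⟩
  · exact absurd h.symm (HexKernel.outFace_ne_face x (j + 1) b)

/-- Consecutive faces of the hexagon around `x` are adjacent and both contain `x`. [folklore] -/
theorem face_adj_face_succ (x : Site 2) (k : Fin 6) :
    hexGraph.Adj (HexKernel.face x k) (HexKernel.face x (k + 1)) := by
  obtain ⟨j, rfl⟩ : ∃ j, k = j + 1 := ⟨k - 1, (sub_add_cancel k 1).symm⟩
  exact (HexKernel.adj_face_iff HexKernel.hexGraph_adj_iff_of_snd_eq_zero_holds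
    HexKernel.not_hexGraph_adj_of_snd_eq_holds x j _).2 (Or.inr (Or.inl rfl))

/-- The cyclic parity fact behind the local evenness: in a cyclic `0/1`-sequence of length `6` the
numbers of `10`- and of `01`-transitions have even sum. [folklore] -/
theorem even_transitions (f : Fin 6 → Bool) :
    Even ((Finset.univ.filter fun k : Fin 6 => f k = true ∧ f (k + 1) = false).card +
      (Finset.univ.filter fun k : Fin 6 => f (k + 1) = true ∧ f k = false).card) := by
  revert f
  decide

/-- **Local parity.** For every finite `Λ` and every site `x`, the boundary darts `(v, t)`
(`v ∈ Λ`, `t ∉ Λ`, `v ∼ t`) whose dual edge contains `x` are even in number: they are the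
`Λ → Λᶜ` and `Λᶜ → Λ` transitions around the hexagon of `x`. [folklore] -/
theorem even_card_dartsAt (x : Site 2) (D : Finset (HexVertex × HexVertex))
    (hD : ∀ d, d ∈ D ↔ d.1 ∈ Λ ∧ d.2 ∉ Λ ∧ hexGraph.Adj d.1 d.2) :
    Even (D.filter fun d => x ∈ hexFaceVertices d.1 ∧ x ∈ hexFaceVertices d.2).card := by
  classical
  set I₁ : Finset (Fin 6) :=
    Finset.univ.filter fun k => HexKernel.face x k ∈ Λ ∧ HexKernel.face x (k + 1) ∉ Λ with hI₁
  set I₂ : Finset (Fin 6) :=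
    Finset.univ.filter fun k => HexKernel.face x (k + 1) ∈ Λ ∧ HexKernel.face x k ∉ Λ with hI₂
  let g₁ : Fin 6 → HexVertex × HexVertex := fun k => (HexKernel.face x k, HexKernel.face x (k + 1))
  let g₂ : Fin 6 → HexVertex × HexVertex := fun k => (HexKernel.face x (k + 1), HexKernel.face x k)
  have hmemF : ∀ k, x ∈ hexFaceVertices (HexKernel.face x k) := mem_hexFaceVertices_face x
  -- the darts at `x` are the images of the two transition sets
  have hset : (D.filter fun d => x ∈ hexFaceVertices d.1 ∧ x ∈ hexFaceVertices d.2) =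
      I₁.image g₁ ∪ I₂.image g₂ := by
    ext d
    simp only [Finset.mem_filter, Finset.mem_union, Finset.mem_image, hI₁, hI₂, Finset.mem_univ,
      true_and, hD]
    constructor
    · rintro ⟨⟨hv, ht, hadj⟩, hxv, hxt⟩
      obtain ⟨k, ⟨h1, h2⟩ | ⟨h1, h2⟩⟩ := exists_face_eq_of_adj x hadj hxv hxt
      · exact Or.inl ⟨k, ⟨h1 ▸ hv, h2 ▸ ht⟩, Prod.ext h1.symm h2.symm⟩
      · exact Or.inr ⟨k, ⟨h1 ▸ hv, h2 ▸ ht⟩, Prod.ext h1.symm h2.symm⟩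
    · rintro (⟨k, ⟨h1, h2⟩, rfl⟩ | ⟨k, ⟨h1, h2⟩, rfl⟩)
      · exact ⟨⟨h1, h2, face_adj_face_succ x k⟩, hmemF k, hmemF (k + 1)⟩
      · exact ⟨⟨h1, h2, (face_adj_face_succ x k).symm⟩, hmemF (k + 1), hmemF k⟩
  have hinj₁ : Set.InjOn g₁ I₁ := fun a _ b _ h => (HexKernel.face_inj x a b).1 (Prod.mk.inj h).1
  have hinj₂ : Set.InjOn g₂ I₂ := fun a _ b _ h => (HexKernel.face_inj x a b).1 (Prod.mk.inj h).2
  have hdisj : Disjoint (I₁.image g₁) (I₂.image g₂) := by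
    rw [Finset.disjoint_left]
    rintro d hd₁ hd₂
    obtain ⟨a, -, rfl⟩ := Finset.mem_image.1 hd₁
    obtain ⟨b, -, hab⟩ := Finset.mem_image.1 hd₂
    have e1 : b + 1 = a := (HexKernel.face_inj x _ _).1 (Prod.mk.inj hab).1
    have e2 : b = a + 1 := (HexKernel.face_inj x _ _).1 (Prod.mk.inj hab).2
    rw [e2] at e1
    have := congrArg Fin.val e1
    simp [Fin.val_add] at this
    omega
  rw [hset, Finset.card_union_of_disjoint hdisj, Finset.card_image_of_injOn hinj₁,
    Finset.card_image_of_injOn hinj₂]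
  have key := even_transitions fun k => decide (HexKernel.face x k ∈ Λ)
  have e₁ : (Finset.univ.filter fun k : Fin 6 => decide (HexKernel.face x k ∈ Λ) = true ∧
      decide (HexKernel.face x (k + 1) ∈ Λ) = false) = I₁ := by
    rw [hI₁]; congr 1; ext k; simp
  have e₂ : (Finset.univ.filter fun k : Fin 6 => decide (HexKernel.face x (k + 1) ∈ Λ) = true ∧
      decide (HexKernel.face x k ∈ Λ) = false) = I₂ := by
    rw [hI₂]; congr 1; ext k; simp
  rw [e₁, e₂] at key
  exact key

/-! ### The bridge lemma -/

/-- **The root edge is no bridge of the boundary-site graph.**  For a finite `Λ` whose root dart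
`((ka,m,0) ∈ Λ, (ka,m-1,1) ∉ Λ)` is a boundary dart, the two sites `(ka, m)`, `(ka+1, m)` of its
dual edge are joined in the boundary-site graph WITHOUT the root: otherwise the component `C` of
`(ka, m)` contains exactly one of them, so the incidences (site of `C`, boundary dart other than the
root) number `Σ_{x ∈ C} (deg x) − 1`, odd by the local parity — yet every such dart meeting `C`
has both its sites in `C`, an even count. [folklore] -/
theorem rootSites_joined {ka m : ℤ} (hU : ((![ka, m], 0) : HexVertex) ∈ Λ)
    (hB : ((![ka, m - 1], 1) : HexVertex) ∉ Λ) :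
    Relation.ReflTransGen (fun p q : Site 2 => p ≠ q ∧ ∃ v ∈ Λ, ∃ t : HexVertex, t ∉ Λ ∧
        hexGraph.Adj v t ∧
        s(t, v) ≠ s((((![ka, m - 1] : Site 2)), (1 : Fin 2)), ((![ka, m] : Site 2), (0 : Fin 2))) ∧
        p ∈ hexFaceVertices v ∧ p ∈ hexFaceVertices t ∧
        q ∈ hexFaceVertices v ∧ q ∈ hexFaceVertices t) ![ka, m] ![ka + 1, m] := by
  classical
  set R' : Site 2 → Site 2 → Prop := fun p q => p ≠ q ∧ ∃ v ∈ Λ, ∃ t : HexVertex, t ∉ Λ ∧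
    hexGraph.Adj v t ∧
    s(t, v) ≠ s((((![ka, m - 1] : Site 2)), (1 : Fin 2)), ((![ka, m] : Site 2), (0 : Fin 2))) ∧
    p ∈ hexFaceVertices v ∧ p ∈ hexFaceVertices t ∧
    q ∈ hexFaceVertices v ∧ q ∈ hexFaceVertices t with hR'
  by_contra hnot
  have hadjBU : hexGraph.Adj ((![ka, m - 1], 1) : HexVertex) (![ka, m], 0) := by
    rw [hexGraph_adj_iff_coord]; simp
  -- the sites of `Λ`, the component of `(ka, m)`, the boundary darts
  set S : Finset (Site 2) := Λ.biUnion hexFaceVertices with hS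
  set C : Finset (Site 2) := S.filter fun x => Relation.ReflTransGen R' ![ka, m] x with hC
  set D : Finset (HexVertex × HexVertex) :=
    (Λ ×ˢ Λ.biUnion nbrs).filter fun d => d.2 ∉ Λ ∧ hexGraph.Adj d.1 d.2 with hDdef
  have hD : ∀ d, d ∈ D ↔ d.1 ∈ Λ ∧ d.2 ∉ Λ ∧ hexGraph.Adj d.1 d.2 := by
    intro d
    simp only [hDdef, Finset.mem_filter, Finset.mem_product, Finset.mem_biUnion, mem_nbrs_iff]
    exact ⟨fun ⟨⟨h1, _⟩, h2, h3⟩ => ⟨h1, h2, h3⟩, fun ⟨h1, h2, h3⟩ => ⟨⟨h1, d.1, h1, h3⟩, h2, h3⟩⟩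
  set rd : HexVertex × HexVertex := ((![ka, m], 0), (![ka, m - 1], 1)) with hrd
  have hrdD : rd ∈ D := (hD rd).2 ⟨hU, hB, hadjBU.symm⟩
  let inc : Site 2 → HexVertex × HexVertex → Prop := fun x d =>
    x ∈ hexFaceVertices d.1 ∧ x ∈ hexFaceVertices d.2
  -- a dart of `D` other than `rd` is a non-root boundary dart
  have hne_root : ∀ d ∈ D, d ≠ rd →
      s(d.2, d.1) ≠ s((((![ka, m - 1] : Site 2)), (1 : Fin 2)), ((![ka, m] : Site 2), (0 : Fin 2))) := by
    intro d hd hdr h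
    obtain ⟨hv, -, -⟩ := (hD d).1 hd
    rcases Sym2.eq_iff.1 h with ⟨h1, h2⟩ | ⟨h1, h2⟩
    · exact hdr (Prod.ext h2 h1)
    · exact hB (h2 ▸ hv)
  -- the root incidence: the sites of `rd` are `(ka, m)` and `(ka + 1, m)`
  have hinc_rd : ∀ x, inc x rd ↔ x = ![ka, m] ∨ x = ![ka + 1, m] := by
    intro x
    constructor
    · exact fun h => floorDart_sites h.1 h.2
    · have e1 : (![ka + 1, m] : Site 2) = ![ka, m] + Pi.single 0 1 := by
        ext i; fin_cases i <;> simp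
      have e2 : (![ka, m] : Site 2) = ![ka, m - 1] + Pi.single 1 1 := by
        ext i; fin_cases i <;> simp
      have e3 : (![ka + 1, m] : Site 2) = ![ka, m - 1] + (Pi.single 0 1 + Pi.single 1 1) := by
        ext i; fin_cases i <;> simp
      rintro (rfl | rfl)
      · exact ⟨(mem_hexFaceVertices_zero).2 (Or.inl rfl),
          (mem_hexFaceVertices_one).2 (Or.inr (Or.inl e2))⟩
      · exact ⟨(mem_hexFaceVertices_zero).2 (Or.inr (Or.inl e1)),
          (mem_hexFaceVertices_one).2 (Or.inr (Or.inr e3))⟩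
  have hA : (![ka, m] : Site 2) ∈ C :=
    Finset.mem_filter.2 ⟨Finset.mem_biUnion.2 ⟨_, hU, ((hinc_rd _).2 (Or.inl rfl)).1⟩,
      Relation.ReflTransGen.refl⟩
  have hA' : (![ka + 1, m] : Site 2) ∉ C := fun h => hnot (Finset.mem_filter.1 h).2
  -- closure of `C` under non-root darts
  have hclos : ∀ d ∈ D, d ≠ rd → ∀ x y, inc x d → inc y d → x ∈ C → y ∈ C := by
    intro d hd hdr x y hx hy hxC
    by_cases hxy : x = y
    · rwa [← hxy]
    obtain ⟨hv, ht, hadj⟩ := (hD d).1 hd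
    refine Finset.mem_filter.2 ⟨Finset.mem_biUnion.2 ⟨d.1, hv, hy.1⟩,
      (Finset.mem_filter.1 hxC).2.tail ⟨hxy, d.1, hv, d.2, ht, hadj, hne_root d hd hdr,
        hx.1, hx.2, hy.1, hy.2⟩⟩
  -- (a) double counting: the incidences (site of `C`, dart ≠ rd) are even in number
  have heven1 : Even (∑ x ∈ C, ((D.erase rd).filter (inc x)).card) := by
    have hdc : ∑ x ∈ C, ((D.erase rd).filter (inc x)).card =
        ∑ d ∈ D.erase rd, (C.filter fun x => inc x d).card := by
      simp only [Finset.card_filter]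
      exact Finset.sum_comm
    rw [hdc]
    refine Finset.even_sum _ fun d hd => ?_
    obtain ⟨hdr, hdD⟩ := Finset.mem_erase.1 hd
    by_cases h0 : ∃ x ∈ C, inc x d
    · obtain ⟨x, hxC, hx⟩ := h0
      have e : (C.filter fun y => inc y d) = hexFaceVertices d.1 ∩ hexFaceVertices d.2 := by
        ext y
        simp only [Finset.mem_filter, Finset.mem_inter]
        exact ⟨fun h => h.2, fun h => ⟨hclos d hdD hdr x y hx h hxC, h⟩⟩
      rw [e, ((hexGraph_adj_iff _ _).1 ((hD d).1 hdD).2.2).2]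
      exact ⟨1, rfl⟩
    · have e : (C.filter fun y => inc y d) = ∅ :=
        Finset.filter_eq_empty_iff.2 fun y hy hyd => h0 ⟨y, hy, hyd⟩
      rw [e]
      exact ⟨0, rfl⟩
  -- (b) per site: the non-root incidences plus the root incidence are all incidences, even
  have hsite : ∀ x, ((D.erase rd).filter (inc x)).card +
      (if x = ![ka, m] ∨ x = ![ka + 1, m] then 1 else 0) = (D.filter (inc x)).card := by
    intro x
    rw [Finset.filter_erase]
    by_cases hx : x = ![ka, m] ∨ x = ![ka + 1, m]
    · rw [if_pos hx]
      exact Finset.card_erase_add_one (Finset.mem_filter.2 ⟨hrdD, (hinc_rd x).2 hx⟩)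
    · rw [if_neg hx, add_zero, Finset.erase_eq_of_notMem]
      exact fun h => hx ((hinc_rd x).1 (Finset.mem_filter.1 h).2)
  have hsum : ∑ x ∈ C, ((D.erase rd).filter (inc x)).card +
      (C.filter fun x => x = ![ka, m] ∨ x = ![ka + 1, m]).card =
      ∑ x ∈ C, (D.filter (inc x)).card := by
    rw [Finset.card_filter, ← Finset.sum_add_distrib]
    exact Finset.sum_congr rfl fun x _ => hsite x
  have hone : (C.filter fun x => x = ![ka, m] ∨ x = ![ka + 1, m]).card = 1 := by
    rw [Finset.card_eq_one]
    refine ⟨![ka, m], ?_⟩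
    ext x
    simp only [Finset.mem_filter, Finset.mem_singleton]
    constructor
    · rintro ⟨hxC, rfl | rfl⟩
      · rfl
      · exact absurd hxC hA'
    · rintro rfl
      exact ⟨hA, Or.inl rfl⟩
  have heven2 : Even (∑ x ∈ C, (D.filter (inc x)).card) :=
    Finset.even_sum _ fun x _ => even_card_dartsAt x D hD
  rw [← hsum, hone, Nat.even_add_one] at heven2
  exact heven2 heven1

/-! ### Reachability without the root -/

/-- **Rerouting through the bridge lemma**: a chain in the boundary-site graph WITH the root edge
gives one WITHOUT it (every root step is replaced by the detour of `rootSites_joined`).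
[folklore] -/
theorem reach_without_root {ka m : ℤ} (hU : ((![ka, m], 0) : HexVertex) ∈ Λ)
    (hB : ((![ka, m - 1], 1) : HexVertex) ∉ Λ) {p q : Site 2}
    (h : Relation.ReflTransGen (fun a b : Site 2 => a ≠ b ∧ ∃ v ∈ Λ, ∃ t : HexVertex, t ∉ Λ ∧
        hexGraph.Adj v t ∧ a ∈ hexFaceVertices v ∧ a ∈ hexFaceVertices t ∧
        b ∈ hexFaceVertices v ∧ b ∈ hexFaceVertices t) p q) :
    Relation.ReflTransGen (fun a b : Site 2 => a ≠ b ∧ ∃ v ∈ Λ, ∃ t : HexVertex, t ∉ Λ ∧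
        hexGraph.Adj v t ∧
        s(t, v) ≠ s((((![ka, m - 1] : Site 2)), (1 : Fin 2)), ((![ka, m] : Site 2), (0 : Fin 2))) ∧
        a ∈ hexFaceVertices v ∧ a ∈ hexFaceVertices t ∧
        b ∈ hexFaceVertices v ∧ b ∈ hexFaceVertices t) p q := by
  classical
  have hsymm : ∀ {a b : Site 2}, Relation.ReflTransGen (fun a b : Site 2 => a ≠ b ∧ ∃ v ∈ Λ,
      ∃ t : HexVertex, t ∉ Λ ∧ hexGraph.Adj v t ∧
      s(t, v) ≠ s((((![ka, m - 1] : Site 2)), (1 : Fin 2)), ((![ka, m] : Site 2), (0 : Fin 2))) ∧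
      a ∈ hexFaceVertices v ∧ a ∈ hexFaceVertices t ∧
      b ∈ hexFaceVertices v ∧ b ∈ hexFaceVertices t) a b →
      Relation.ReflTransGen (fun a b : Site 2 => a ≠ b ∧ ∃ v ∈ Λ, ∃ t : HexVertex, t ∉ Λ ∧
      hexGraph.Adj v t ∧
      s(t, v) ≠ s((((![ka, m - 1] : Site 2)), (1 : Fin 2)), ((![ka, m] : Site 2), (0 : Fin 2))) ∧
      a ∈ hexFaceVertices v ∧ a ∈ hexFaceVertices t ∧
      b ∈ hexFaceVertices v ∧ b ∈ hexFaceVertices t) b a := by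
    intro a b hab
    induction hab with
    | refl => exact Relation.ReflTransGen.refl
    | tail _ hbc ih =>
      obtain ⟨hne, v, hv, t, ht, hvt, hr, hbv, hbt, hcv, hct⟩ := hbc
      exact Relation.ReflTransGen.head ⟨hne.symm, v, hv, t, ht, hvt, hr, hcv, hct, hbv, hbt⟩ ih
  induction h with
  | refl => exact Relation.ReflTransGen.refl
  | tail _ hbc ih =>
    obtain ⟨hne, v, hv, t, ht, hvt, hbv, hbt, hcv, hct⟩ := hbc
    by_cases hr : s(t, v) = s((((![ka, m - 1] : Site 2)), (1 : Fin 2)), ((![ka, m] : Site 2), (0 : Fin 2)))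
    · -- a root step: detour
      have hvt' : t = (![ka, m - 1], 1) ∧ v = (![ka, m], 0) := by
        rcases Sym2.eq_iff.1 hr with ⟨h1, h2⟩ | ⟨h1, h2⟩
        · exact ⟨h1, h2⟩
        · exact absurd (h2 ▸ hv) hB
      rw [hvt'.1] at hbt hct
      rw [hvt'.2] at hbv hcv
      have key := rootSites_joined hU hB
      rcases floorDart_sites hbv hbt with hb | hb <;> rcases floorDart_sites hcv hct with hc | hc
      · exact absurd (hb.trans hc.symm) hne
      · rw [hc]; rw [hb] at ih; exact ih.trans key
      · rw [hc]; rw [hb] at ih; exact ih.trans (hsymm key)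
      · exact absurd (hb.trans hc.symm) hne
    · exact ih.tail ⟨hne, v, hv, t, ht, hvt, hr, hbv, hbt, hcv, hct⟩

/-! ### The registered reduction -/

/-- **Registered sub-goal `stub_halfPlaneInputs_boundaryReachOfConnected`** (crux
stmt-CriticalPhenomena-14004, line `pick-half-plane`, serving `stub_halfPlaneInputs`, wave 5):
`BoundarySiteGraphConnected → BoundaryReach` — if all non-interior lattice sites of a simply
connected, connected `Λ` lie in ONE component of the boundary-site graph (root edge allowed), then
every non-interior lattice site is reachable from the normaliser's site WITHOUT the root edge
(`reach_without_root`: the root edge is no bridge, by the parity of the boundary degrees).  The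
hypothesis is the remaining global input (the boundary of a simply connected, connected hex domain
is one circuit). [folklore] -/
theorem stub_halfPlaneInputs_boundaryReachOfConnected :
    (∀ (Λ : Finset HexVertex), hexDomainSimplyConnected Λ →
      (hexGraph.induce ((Λ : Finset HexVertex) : Set HexVertex)).Preconnected →
      ∀ (p q : Site 2), IsLatticeSite Λ p → ¬ IsInteriorSite Λ p →
        IsLatticeSite Λ q → ¬ IsInteriorSite Λ q →
        Relation.ReflTransGen (fun a b : Site 2 => a ≠ b ∧ ∃ v ∈ Λ, ∃ t : HexVertex, t ∉ Λ ∧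
          hexGraph.Adj v t ∧ a ∈ hexFaceVertices v ∧ a ∈ hexFaceVertices t ∧
          b ∈ hexFaceVertices v ∧ b ∈ hexFaceVertices t) p q) →
    ∀ (Λ : Finset HexVertex), hexDomainSimplyConnected Λ →
      (hexGraph.induce ((Λ : Finset HexVertex) : Set HexVertex)).Preconnected →
    ∀ (m k₁ k₂ ka : ℤ), (∀ k : ℤ, k₁ ≤ k → k ≤ k₂ → ((![k, m], 0) : HexVertex) ∈ Λ ∧
        ((![k, m - 1], 1) : HexVertex) ∉ Λ ∧ (k < k₂ → ((![k, m], 1) : HexVertex) ∈ Λ) ∧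
        ((![k, m - 1], 0) : HexVertex) ∉ Λ) → k₁ ≤ ka → ka ≤ k₂ →
    ∀ (ub wb : HexVertex), hexGraph.Adj ub wb → ub ∉ Λ → wb ∈ Λ →
      (∀ k : ℤ, k₁ ≤ k → k ≤ k₂ →
        s(ub, wb) ≠ s((((![k, m - 1] : Site 2)), (1 : Fin 2)), ((![k, m] : Site 2), (0 : Fin 2)))) →
    ∀ (sb : Site 2), sb ∈ hexFaceVertices ub → sb ∈ hexFaceVertices wb →
    ∀ (s : Site 2), IsLatticeSite Λ s → ¬ IsInteriorSite Λ s →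
      Relation.ReflTransGen (fun p q : Site 2 => p ≠ q ∧ ∃ v ∈ Λ, ∃ t : HexVertex, t ∉ Λ ∧
        hexGraph.Adj v t ∧
        s(t, v) ≠ s((((![ka, m - 1] : Site 2)), (1 : Fin 2)), ((![ka, m] : Site 2), (0 : Fin 2))) ∧
        p ∈ hexFaceVertices v ∧ p ∈ hexFaceVertices t ∧
        q ∈ hexFaceVertices v ∧ q ∈ hexFaceVertices t) sb s := by
  intro hconn Λ hΛ hpre m k₁ k₂ ka hF4 hka₁ hka₂ ub wb _ hub hwb _ sb hsbu hsbw s hs hs'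
  exact reach_without_root (hF4 ka hka₁ hka₂).1 (hF4 ka hka₁ hka₂).2.1
    (hconn Λ hΛ hpre sb s ⟨wb, hwb, hsbw⟩ (fun h => hub (h ub hsbu)) hs hs')

end Summit.CriticalPhenomena.SAWScalingLimit.Theorems.PickHalfPlane.BoundaryExactness
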